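import Literature.RepresentationTheory.BorelWallach2000.UpqHarmonicHodgeDecomposition
import Literature.RepresentationTheory.BorelWallach2000.UpqConjugateModule
import Literature.RepresentationTheory.BorelWallach2000.UpqTypeFunctoriality
import Literature.RepresentationTheory.BorelWallach2000.AdmissibleFiniteCochains
import Literature.NumberTheory.Automorphic.GKModules
import Summits.HodgeConjecture.HodgeConjecture.Theorems.F0P3bStubT6eCasimirScalar
import Summits.HodgeConjecture.HodgeConjecture.Theorems.F0P3bStubT3jCocycleValuesPNull
import Summits.HodgeConjecture.HodgeConjecture.Theorems.F0P3bStubT6dAdmissibleBridge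
import Summits.HodgeConjecture.HodgeConjecture.Theorems.F0P3bStubT6kU21PGeometry
import Summits.HodgeConjecture.HodgeConjecture.Theorems.F0P3bStubT6rPNullRigidity
import Summits.HodgeConjecture.HodgeConjecture.Theorems.F0P3bStubT6gPNullGeneration
import Summits.HodgeConjecture.HodgeConjecture.Theorems.F0P3bStubT6aDegOneTypePure
import HarnessLib

-- ED. 2 registrar pass (A-plan1 (g18), 2026-08-30T23:2xZ; director s355 cure as on every 24833 line since T1 ed. 1.2): every `[cite: …]` tag inside a
-- `def`/`abbrev`/`structure` docstring of F0P3b-plan (g2)՚s ed. 2 (sha16 5707473c2744e711) is rewritten as prose `(print: …)`; tags on THEOREM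
-- docstrings kept; all declarations byte-identical to 5707473c2744e711.
-- ED. 2.1 (F0P3b-plan (g3), 2026-08-30T23:3xZ): T6d FOLDED BY NAME onto the ★ closer `Theorems/F0P3bStubT6dAdmissibleBridge`
-- (A-p12 (g12), p794411): `stub_T6d_admissibleBridge := F0P3bStubT6dAdmissibleBridge.stubT6d_holds`; one import added; every `def`
-- byte-identical to ed. 2 (843c62f29c241097); `sorry` now ONLY in T6g, T6r, T6k.
-- ED. 2.2 (F0P3b-plan (g3), 2026-08-30T23:4xZ): T6k FOLDED BY NAME onto the ★ closer `Theorems/F0P3bStubT6kU21PGeometry`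
-- (F0P3-p04 (g2), p795304): `stub_T6k_u21PGeometry := F0P3bStubT6kU21PGeometry.stubT6k_holds`; one import added; every `def`
-- byte-identical to ed. 2 ∕ 2.1; `sorry` now ONLY in T6g, T6r (T6b is thereby kernel-closed modulo T6g alone, T6c modulo T6r alone).
-- ED. 3 (F0P3b-plan (g3), 2026-08-31T00:0xZ): **NO `sorry` REMAINS — every registered stub of the engine sub-line is ★.**  T6r and T6g
-- FOLDED BY NAME onto the ★ closers `Theorems/F0P3bStubT6rPNullRigidity` (F0P3-p03 (g2), p796374; over ★ `Theorems/F0P3bGKPairGlue`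
-- p795810) and `Theorems/F0P3bStubT6gPNullGeneration` (F0P3-p04 (g2), p796658): `stub_T6r_pNullRigidity := F0P3bStubT6rPNullRigidity.stubT6r_holds`,
-- `stub_T6g_pNullGeneration := F0P3bStubT6gPNullGeneration.stubT6g_holds`; T6a ∕ T6b ∕ T6c (derived `t6a_of` ∕ `t6b_of` ∕ `t6c_of`) and the
-- package head `archDegOnePackage_holds` are thereby KERNEL-CLOSED OUTRIGHT (axioms `propext ∕ Classical.choice ∕ Quot.sound`); the SECOND,
-- DIRECT road to T6a is recorded as `t6a_direct := F0P3bStubT6aDegOneTypePure.stubT6a_holds` (F0P3-p01 (g2), ★ p796166).  Four imports added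
-- (the three closers; ★ `BorelWallach2000.UpqTypeFunctoriality` for §4); every `def` byte-identical to ed. 2 ∕ 2.1 ∕ 2.2.  NEW §4 (sorry-free):
-- type transport under `GKEquiv` (`upqTypeClasses_ne_bot_of_gkEquiv`) and «J⁺ ≇ J⁻» (`hol_antihol_inequivalent` ∕ `antihol_hol_inequivalent`,
-- the ARCHIMEDEAN END of letter E2′).  Floor-importable twin: ★ `Theorems/F0P3bArchDegOnePackageDefs.lean` (p796373, defs VERBATIM) +
-- `Theorems/F0P3bArchDegOnePackage.lean` (F0P3-p04 (g2), the same folds; filing).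
/-!
# F0 · ENGINE local packets (T3 ∕ T4 ∕ T6) — line skeleton, edition 3 — SORRY-FREE (cell hodgecm-mathlib, unit F0P3b-plan g2 ∕ g3)

Crux dossier `Cruxes/H413/` of `stmt-HodgeConjecture-24833`
(`Summit.HodgeConjecture.HodgeConjecture.Theses.HCCMUnconditional.H413`); sub-line of the ENGINE integrator's
line of record `Lines/F0_U3CohMultOne.lean` (F0P3-plan; stubs S1–S5, heads `multiplicity_le_one_printed_holds_of`,
`hJ3a_of_stubs`, `H413_of_P3`).  Edition 1 = commit 3688d7ee18c0 (sha16 808dda7dd1cd10bb, unit F0P3b-plan g0): six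
stubs T6a–T6e, T3j.  Scope of THIS sub-line (NAMING ORDER v2 §A.7; scope audit fcd7d1e5 §3): the LOCAL PACKET inputs
of Rogawski's multiplicity-one ∕ rigidity engine —

* **T6 archimedean cohomology** [Rogawski1990 Prop. 15.2.1 (b) p. 244; BorelWallach2000 VI Thm. 4.11 p. 131]:
  for `G_∞ = U(2,1)` and trivial coefficients the irreducible unitary `(𝔤, K)`-modules with `H¹ ≠ 0` are exactly
  `J⁺ = J_{1,0}` (type `(1,0)`) and `J⁻ = J_{0,1}` (type `(0,1)`), each with `dim_ℂ H¹ = 1`;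
* **T3 archimedean A-packets** [Rogawski1990 §12.3 pp. 174–178, Prop. 12.3.3 (a)]: `Π(ξ_∞) = {πⁿ(ξ_∞), πˢ(ξ_∞)}`,
  `πⁿ(ξ(b,a,c)) = J_φ⁺`, `πⁿ(ξ(a,c,b)) = J_φ⁻`, `Tr ξ(f^H) = Tr πⁿ(ξ)(f) + Tr πˢ(ξ)(f)`; for trivial coefficients
  `ξ⁺_∞ = ξ(0,1,−1) ↦ J⁺`, `ξ⁻_∞ = ξ(1,−1,0) ↦ J⁻`; compact real places `v ∈ S₀` [Prop. 14.4.1 (a), 14.4.2 (c)];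
* **T4 p-adic packets** [Rogawski1990 §12.2 case (2) p. 173, Prop. 13.1.3 (d), 13.1.4 p. 192; GelbartRogawski1991
  Lem. 5.1.2]: `Π(ξ_v) = {πⁿ(ξ_v), πˢ(ξ_v)}` (`v` inert ∕ ramified), `= {πⁿ(ξ_v)}` (`v` split),
  `χ_ξ(f^H) = Σ_{π ∈ Π(ξ_v)} χ_π(f)`.

## Thesis of the sub-line (unchanged) and what edition 2 changes

The engine consumes T3∕T4∕T6 in two currencies: (i) **cohomological currency** (Hodge types of `(𝔤, K)`-cohomology
in degree 1, `(𝔤, K)`-equivalence) — what the letters E1′ `cohFinComponentUnique_hol∕_antihol`, E1″ and E2′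
`hodgeTypeRigid` (`Literature.NumberTheory.Rogawski1990.CohomologicalSpectrumInnerForm`) need at the archimedean
place, and what P2a's B4 desk (`dim H¹(𝔤,K;J^±)_{τ′} ≤ 1`) needs; (ii) **trace currency** (distribution characters,
transfer `f ↦ f^H`, local A-packets as finite sets of classes of irreducible admissible representations of `G′_v`) —
consumed only inside T1∕T5∕T7 (P3a's statement layer `Lines/F0_T1InnerFormTraceIdentity.lean`, whose
`ComparisonKit.PacketG ∕ PacketH` are POSITED abstract carriers, and the parent's count).  Currency (i) has HONEST
carriers in the tree (the Borel–Wallach `U(α, β)` layer over the generic `(𝔤, K)`-module layer); currency (ii) has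
none (ENGINE-CARRIER-CENSUS.F0typ1 §2; `Rogawski1990/U3Spectrum`, `GelbartRogawski1991/LocalAPackets`, `SUn1Table`
are DICTIONARY level).  **So, as in edition 1, the registered stubs carry the currency-(i) content of T6 and T3, and
T3-trace ∕ T4 stay §4 items + definition requests D1–D3** (interface-vs-constructed rule: a local A-packet is an
INTERFACE datum of the T1 layer plus a separate CONSTRUCTION statement, never smuggled into a structure's axioms).

**Edition 2 (this file) changes exactly two things.**  (a) **T6e and T3j are ★** (and, edition 2.1, **T6d**; edition 2.2, **T6k**; edition 3, **T6r and T6g** — all seven): `StubT6eCasimirScalar` and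
`StubT3jCocycleValuesPNull` (defs VERBATIM) are now the theorems `stub_T6e_casimirScalar :=
F0P3bStubT6eCasimirScalar.stubT6e_holds` (closer `Theorems/F0P3bStubT6eCasimirScalar.lean`, p792178) and
`stub_T3j_cocycleValuesPNull := F0P3bStubT3jCocycleValuesPNull.stubT3j_holds` (closer
`Theorems/F0P3bStubT3jCocycleValuesPNull.lean`, p793345), both A-p09 (g18), no `sorry` behind them; the T6d closer
`Theorems/F0P3bStubT6dAdmissibleBridge.lean` (A-p12 (g12), rf 0e14f189949d7c35, twin GREEN ×2 22:58Z) is ★ p794411 and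
FOLDED the same way (`stub_T6d_admissibleBridge := F0P3bStubT6dAdmissibleBridge.stubT6d_holds`) in edition 2.1; the T6k closer `Theorems/F0P3bStubT6kU21PGeometry.lean` (F0P3-p04 (g2), rf 4b0d9bd2bf009b25) is ★ p795304 and
FOLDED (`stub_T6k_u21PGeometry := F0P3bStubT6kU21PGeometry.stubT6k_holds`) in edition 2.2; the T6r closer `Theorems/F0P3bStubT6rPNullRigidity.lean` (F0P3-p03 (g2), rf v2 dadee0f1cf29aeac, over ★ `F0P3bGKPairGlue` p795810) is ★ p796374 and
FOLDED (`stub_T6r_pNullRigidity := F0P3bStubT6rPNullRigidity.stubT6r_holds`) in edition 3 (this file); the T6g closer `Theorems/F0P3bStubT6gPNullGeneration.lean` (F0P3-p04 (g2), rf 0e42d65505e37771, over ★ (B)(C) of F0P3-p01 (g2) + ★ `F0P3bGKPairGlue`) is ★ p796658 and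
FOLDED (`stub_T6g_pNullGeneration := F0P3bStubT6gPNullGeneration.stubT6g_holds`) in edition 3 (this file) — **no `sorry` remains**; the DIRECT T6a closer `Theorems/F0P3bStubT6aDegOneTypePure.lean` (F0P3-p01 (g2), ★ p796166) is recorded as the alternative road `t6a_direct`.  (b) **T6a ∕ T6b ∕ T6c are
RE-CUT**: their defs stay VERBATIM (so every consumer's fold is unchanged), but they are now KERNEL-CHECKED
CONSEQUENCES (`t6a_of`, `t6b_of`, `t6c_of`, axioms `propext ∕ Classical.choice ∕ Quot.sound` only) of T3j and three NEW
generic stubs T6g ∕ T6r ∕ T6k — the «lowest `K`-type generates a `z₀`-graded ladder» engine.  This takes the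
Kovačević NECESSITY classification of irreducible `(𝔰𝔲(2,1), K)`-modules (surv3 gap G2, L–XL, source Kraljević not
held) and the complexification transport (G3) OFF the critical path of T6c (edition-1 estimate 40–60 seat-hours →
15–25), and needs neither unitarity nor admissibility for T6a∕b∕c (the defs keep those hypotheses; the proofs do not
use them).  Registered stubs of edition 2 (§2): **T6d** (M; ★ p794411, folded in ed. 2.1), **T6g** (M–L; ★ p796658, folded in ed. 3),
**T6r** (M–L; ★ p796374, folded in ed. 3), **T6k** (S–M; ★ p795304, folded in ed. 2.2) — NO `sorry` since edition 3; head `archDegOnePackage_holds_of_ed2 : T6d → T6g → T6r → T6k → ArchDegOnePackage`.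

## Strategy of edition 2 (how provers discharge §2, and why T6a∕b∕c follow)

Fix `δ = ±1` and a non-zero `(𝔤, K)`-1-cochain `f` of type `δ` (`f(𝔨) = 0`, `f(JX) = δ i f(X)`, `ρK(k) f(X) =
f(Ad k X)`, `ρ(Y) f(X) = f(⁅Y, X⁆)` for `Y ∈ 𝔨` — all from `upqType` ∕ `gkComplex` membership, glue lemmas §2′) whose
values are `𝔭^{−δ}`-null (`IsPNull`; for a COCYCLE this is ★ **T3j**, the junction lemma: `ρ(X)f(Y) = ρ(Y)f(X)` on
`𝔭 × 𝔭` plus the type).  Then `W := span_ℂ f(𝔤) = f(𝔭)` is `K`- and `𝔨`-stable, killed by `𝔭^{−δ}`, of `z₀`-weight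
`δ i`, and `Σ_k ρ(𝔭^δ)^k W` is a non-zero `(𝔤, K)`-submodule (PBW reordering with `ρ(Y^±) = ½(ρ(Y) ∓ i ρ(JY)) ∈
End_ℂ V`, `[𝔭^δ, 𝔭^δ] = 0`, `[𝔭^{−δ}, 𝔭^δ] ⊆ 𝔨_ℂ`, `[𝔨, 𝔭^±] ⊆ 𝔭^±`), hence ALL of an irreducible `V`, GRADED by the
`z₀`-weights `δ(k+1)i` with degree-`0` piece `W` — STUB **T6g** (conclusions typed: the `z₀`-spectrum is
`{δ(k+1)i}`; the `δ i`-eigenspace is `W`).  **T6a** follows (a `(1,0)`-cocycle forces spectrum `{(k+1)i}`, a non-zero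
`(0,1)`-cocycle has a value of weight `−i`); with the `U(2,1)` `𝔭`-geometry STUB **T6k** (`ker f = 𝔨` since
`K = U(2) × U(1)` is transitive on the complex lines of `𝔭 ≅ ℂ²`; Schur: a second type-`δ` cochain with values in `W`
is `c • f`, `End_K(𝔭^δ) = ℂ`) **T6b** follows (`Z¹_δ ⊆ ℂ • f₀`, real dimension `≤ 2`, so `H¹_δ` too); and STUB **T6r**
(two irreducibles carrying such `f`, `f′` with the same real kernel are `(𝔤, K)`-equivalent: the diagonal submodule
of `V ⊕ V′` generated by the graph of `f(X) ↦ f′(X)` is graded with degree-`0` piece the graph, and both projections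
are isomorphisms) gives **T6c** with T6k (1).  **T6d** (admissibility bridge `IsAdmissibleGK → IsKAdmissible`, generic)
is unchanged: with ★ `moduleFinite_gkComplex_carrier_of_isKAdmissible` it gives BW II 3.4 (1) (`cochainsFinite_of_T6d`)
— the standing hypothesis of II 4.5 for P2a∕P4a; T6e ★ + `gkCohomology_casimir_dichotomy` give `d = 0` on
cohomological `V`.  The Kovačević ★ instance (`Kovacevic2021/*`: `ladderPlus = J_{1,0}`, `kovacevicTable_VI_4_11`)
stays the HONEST MODEL the stubs are checked against (T6g's grading is literally the ladder structure of
`ladderPlus ∕ ladderMinus`); the G2∕G3 route of edition 1 remains a documented fallback only.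

## Reuse map (edition 2 = edition 1 ∪ the F0-surv3 REUSE map `F0/survey/REUSE-P2aP4aP3b-archimedean.v1.surv3.md`, §7 addendum cbb42763ee414fcd)

honest & reused BY NAME: `Literature.NumberTheory.Automorphic.GKModules` (115 `IsGKModule`, 169 `IsIrreducibleGK`,
204 `IsAdmissibleGK`, 224 `AreGKEquivalent`), `…GKCohomology` (`gkComplex`, `gkCohomology` + its `Module ℂ`),
`Literature.RepresentationTheory.BorelWallach2000.{UpqHodgeBigrading §41–44′, UpqCasimirTensor §63 (upqCasimirOp,
upqPBasis), GKCohomologyCasimirCriterion (gkCohomology_casimir_dichotomy), RelativeCohomologyCasimirCriterion,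
UpqHarmonicHodgeDecomposition §92–94, AdmissibleFiniteCochains (IsKAdmissible,
moduleFinite_gkComplex_carrier_of_isKAdmissible), UpqConjugateModule (UpqConj.kAct∕lieAct,
cohomologyEquiv_mem_upqTypeClasses_iff: V^c swaps types), TrivialModuleGKCohomology*}`; `Kovacevic2021/*` (55 ★ files:
the six cohomological modules of `SU(2,1)`, `kovacevicTable_VI_4_11∕_4_12`, `SU21CohomologyAllDegrees`);
`Rogawski1990/U3ArchimedeanParameters` (★-computed `langlands_Jpm`, `holomorphyDichotomy_of`, `exists_archParam_iff`); `Literature.RepresentationTheory.KonnoKonno2007.JunctionLinearRealGroup`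
(`uFormGroup α β : RealMatrixGroup ℂ (α ⊕ β)`).  DICTIONARY twins (docstring cross-refs only, never currency):
`BorelWallach2000/SUn1CohomologicalModules` (`SUn1Table.VI_4_11`, `hdim_one_ne_zero_iff`, `J10_Ktypes`),
`Rogawski1990/U3Spectrum`, `GelbartRogawski1991/LocalAPackets`.  Mathlib: `Representation`, `Module.finrank`,
`Submodule`, `LieHom` only — Mathlib has no `(𝔤, K)`-modules, no unitary dual, no `p`-adic smooth representations
(surv3∕surv4 to confirm).  Junction to the letters' group object `BallForms.u21Group` (form `J`, `Fin 3`) vs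
`uFormGroup (Fin 2) (Fin 1)` (form `diag(1,1,−1)`, `Fin 2 ⊕ Fin 1`): a Cayley-transform transport of
`(𝔤, K)`-modules — P2a ∕ P4a desk item (listed §4, J1), not a stub here.
Edition-2 additions, reused BY NAME in §2′: `ChevalleyEilenbergComplex` (`ins_add`, `ins_apply`, `lieDer_one_apply`,
`mem_cocycles_iff`, `toCohomology`), `ChevalleyEilenbergBigrading` (`IsComplexStructureElement.lie_lie_add_mem`),
`UpqHodgeBigrading` (`mem_upqType_iff`, `upqZ0_mem_kInLie`, `upq_isComplexStructureElement`, `upqTypeClasses` =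
`(Z¹ ∩ C¹_δ).map [·]`), `GKCohomology` (`mem_gkComplex_succ_iff`), ★ `Theorems/F0P3bStubT6eCasimirScalar` (`stubT6e_holds`), ★
`Theorems/F0P3bStubT3jCocycleValuesPNull` (`stubT3j_holds`).  surv3 gaps: G1 (Cayley transport, P2a∕P4a desk J1) unchanged; **G2, G3 no longer needed by P3b**.

## §4 Edition-3 items (T3 trace currency, T4) — typed when packet carriers exist (P3a's T1 layer posits `PacketG∕H` only)


* E2-T3a `archAPacket_members` [Rogawski1990 §12.3 p. 178]: over T1's `LocalAPacket (v real, ξ_v)`: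
  `Π(ξ⁺_∞) = {[J⁺], [πˢ(ξ⁺_∞)]}`, `Π(ξ⁻_∞) = {[J⁻], [πˢ(ξ⁻_∞)]}` with `[J^±]` := the class pinned by `T6c`, and
  `πˢ(ξ^±_∞)` square-integrable with `H¹ = 0`; hence **no member of `Π(ξ⁻_∞)` has `H¹_{+1} ≠ 0`** (the clause E2′
  consumes).  Size M (given T1 carriers).  Why it might fail: sign∕normalisation of `ξ(a,b,c)` vs `(m,n,r)` p. 176.
* E2-T3b `archCharIdentity` [Rogawski1990 Prop. 12.3.3 (a)]: `Tr ξ(f^H) = Tr πⁿ(ξ)(f) + Tr πˢ(ξ)(f)` — T1 currency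
  (Shelstad transfer at the real place).  Size L.  Consumed by T5 only.
* E2-T3c `compactPlacePackets` [Rogawski1990 Prop. 14.4.1 (a), 14.4.2 (c)]: at `v ∈ S₀` (`G′_v` compact) `Π′(ξ_v)` is
  one finite-dimensional class or empty, by the printed `m_v n_v` rule.  Size M.  Consumed by T7.
* E2-T4a `padicAPacket_nonsplit` [Rogawski1990 §12.2 (2), 13.1.3 (d), 13.1.4; GelbartRogawski1991 5.1.2]:
  `Π(ξ_v) = {πⁿ(ξ_v), πˢ(ξ_v)}`, `πⁿ` the non-tempered Langlands quotient of `i_G(χ_ξ)`, `πˢ` square-integrable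
  (supercuspidal for `v` inert unramified data), `χ_ξ(f^H) = χ_{πⁿ}(f) + χ_{πˢ}(f)`.  Needs: smooth irreducible
  representations of `U(3)(F_v)`, normalised parabolic induction, characters — definition requests D1–D3 below.
  Size L.  Why it might fail: at ramified `v` the packet description needs [Rogawski1990 12.2] case distinctions.
* E2-T4b `padicAPacket_split` [Rogawski1990 13.1]: `v` split ⇒ `Π(ξ_v) = {πⁿ(ξ_v)}` (a character twist of an
  induced of `GL₃(F_v)`).  Size S–M.
* J1 (P2a∕P4a desk, not this line): Cayley transport `u21Group ↝ uFormGroup (Fin 2) (Fin 1)` of `(𝔤, K)`-modules and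
  of Hodge types; J2: the `(𝔤, K)`-module generated by a `K_c`-invariant holomorphic cotangent form of
  `P : DiscreteAutomorphicRep` is `IsCohUnitaryIrrep` with `H¹_{+1} ≠ 0` (uses `T3j` + `T6e`).
* Definition requests (to F0-typ1 ∕ surv4): D1 `SmoothRep (G(F_v))` + `IsIrreducible∕IsSupercuspidal∕
  IsSquareIntegrable` for `p`-adic reductive `G`; D2 normalised parabolic induction `i_G(χ)` for `U(3)(F_v)` and its
  Langlands quotient; D3 `LocalAPacket` as a T1-interface datum (finite set of classes + character identity slot).
* Routing note (parent bus 2026-08-30): `NonTemperedComponentForcesAPacket` (P3's S-layer) is the INTEGRATOR's item,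
  not a local-packet stub; E2-T3a is what it will consume at `∞` once D3 exists.

Honest label: HC_CM is proved only modulo the printed citations until rung 0 closes; this file asserts nothing —
NO `sorry` since edition 3 (edition 2 had three: T6g, T6r, T6k): seven ★ folds (T6d, T6e, T3j, T6k, T6r, T6g; T6a also ★ directly) and sorry-free derivations ∕ compositions — every statement below is a KERNEL THEOREM of the tree (axioms `propext ∕ Classical.choice ∕ Quot.sound`).
Registry: editions of this workfile go through the registrar desk (director s354 (2)): report-first bytes + sha16 in
`pub/hodgecm-mathlib/F0/P3b/`, `ledger crux write` + evidence by the registrar; NO `ledger skeleton check` on the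
served item (director s335 ∕ NAMING ORDER v2 §D).  Closers restate a stub's def body VERBATIM in a `Theorems/` file
and never import this module (s347).
-/

set_option linter.dupNamespace false

noncomputable section

open scoped TensorProduct

namespace Summit.HodgeConjecture.HodgeConjecture.Cruxes.H413.F0EngineLocalPackets

open Literature.Algebra.Lie Literature.Algebra.Lie.ChevalleyEilenberg
open Literature.NumberTheory.Automorphic
open Literature.RepresentationTheory.BorelWallach2000
open Literature.RepresentationTheory.KonnoKonno2007 Literature.RepresentationTheory.KonnoKonno2007.RealDualPair
open Literature.RepresentationTheory.KonnoKonno2007.RealDualPair.UForm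

-- Mathlib idiom (as in `GKModules`, `GKCohomology`, the `Upq*` files): commutator bracket on `Module.End`
attribute [local instance 100] LieRing.ofAssociativeRing
/-! ## §1 Honest predicates over the Borel–Wallach `U(α, β)` layer -/

section Predicates

variable {α β : Type*} [Fintype α] [DecidableEq α] [Fintype β] [DecidableEq β]
  {V : Type*} [AddCommGroup V] [Module ℂ V]
  (ρK : Representation ℂ (uFormGroup α β).maximalCompact V)
  (ρ𝔤 : (uFormGroup α β).lie →ₗ⁅ℝ⁆ Module.End ℂ V)

/-- **`V` is unitary along `𝔭 ⊕ ℝz₀`**: there is a positive-definite symmetric real form `B` on the carrier (the real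
part of a Hermitian product) for which the `ρ𝔤(x_s)` (`x_s` the `𝔭`-frame `upqPBasis`), `ρ𝔤(z₀)` and `i` are skew —
EXACTLY the hypothesis bundle `hBs hB hBd hadj hBz hBI` of `UpqHarmonicHodgeDecomposition` ∕ `UpqHodgeBigrading`
§44′, packaged as one `Prop`.  (Since `𝔭 ∪ {z₀}` Lie-generates `𝔲(α,β)` for `α, β` nonempty, this is infinitesimal
unitarity of `ρ𝔤`.) (print: BorelWallach2000, II §2.1, §3.1) -/
def IsUnitaryAlongP : Prop :=
  ∃ B : GKCarrier (uFormGroup α β) ρ𝔤 →ₗ[ℝ] GKCarrier (uFormGroup α β) ρ𝔤 →ₗ[ℝ] ℝ,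
    (∀ a b, B a b = B b a) ∧ (∀ a, 0 ≤ B a a) ∧ (∀ a, B a a = 0 → a = 0) ∧
    (∀ (s : (α × β) × Fin 2) (a b : GKCarrier (uFormGroup α β) ρ𝔤),
        B ⁅upqPBasis s, a⁆ b = -B a ⁅upqPBasis s, b⁆) ∧
    (∀ a b : GKCarrier (uFormGroup α β) ρ𝔤, B ⁅upqZ0 α β, a⁆ b = -B a ⁅upqZ0 α β, b⁆) ∧
    (∀ a b : GKCarrier (uFormGroup α β) ρ𝔤, B (Complex.I • a) b = -B a (Complex.I • b))

/-- **An irreducible unitary cohomologically relevant `(𝔤, K)`-module of `U(α, β)`**: the honest hypothesis bundle of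
Rogawski 15.2.1 (b) ∕ BW VI 4.11 — a `(𝔤, K)`-module (`IsGKModule`), irreducible (`IsIrreducibleGK`), admissible
(`IsAdmissibleGK`) and unitary along `𝔭 ⊕ ℝz₀`. (print: Rogawski1990, Prop. 15.2.1 (b)) -/
structure IsCohUnitaryIrrep : Prop where
  gk : IsGKModule (uFormGroup α β) ρK ρ𝔤
  irred : IsIrreducibleGK ρK ρ𝔤
  adm : IsAdmissibleGK ρK
  unit : IsUnitaryAlongP ρ𝔤

/-- **`𝔭^{∓}`-nullity of a vector, really**: `v` is annihilated by `𝔭⁻ = {X + iJX}` (`ε = 1`) resp.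
`𝔭⁺ = {X − iJX}` (`ε = −1`), `J = ad z₀`, i.e. `ρ𝔤(x_s) v + ε i · ρ𝔤(⁅z₀, x_s⁆) v = 0` on the `𝔭`-frame.
(`𝔭^±` = `±i`-eigenspaces of `J` on `𝔭_ℂ`, the tree's convention `C^{p,q} = C^{p+q}_{p−q}`, `UpqHodgeBigrading` §41.)
(print: BorelWallach2000, II §4.1) -/
def IsPNull (ε : ℤ) (v : GKCarrier (uFormGroup α β) ρ𝔤) : Prop :=
  ∀ s : (α × β) × Fin 2, ⁅upqPBasis s, v⁆ + ((ε : ℂ) * Complex.I) • ⁅⁅upqZ0 α β, upqPBasis s⁆, v⁆ = 0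

end Predicates

/-! ## §1′ Archimedean parameter bookkeeping for trivial coefficients (kernel facts, [Rogawski1990 §12.3 p. 176–178]) -/

/-- Rogawski's one-dimensional archimedean parameters `ξ(a,b,c)` as integer triples. (print: Rogawski1990, §12.3 p. 176) -/
abbrev ArchXi : Type := ℤ × ℤ × ℤ

/-- `ξ⁺_∞ = ξ(0, 1, −1)`: the parameter with `πⁿ(ξ⁺_∞) = J⁺ = J_{φ(1,0,−1)}⁺` (type `(1,0)`). (print: Rogawski1990, §12.3 p. 178) -/
def xiPlus : ArchXi := (0, 1, -1)

/-- `ξ⁻_∞ = ξ(1, −1, 0)`: the parameter with `πⁿ(ξ⁻_∞) = J⁻` (type `(0,1)`). (print: Rogawski1990, §12.3 p. 178) -/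
def xiMinus : ArchXi := (1, -1, 0)

/-- The Hodge type (`z₀`-weight `δ = p − q` in degree 1) carried by `πⁿ(ξ)` for the two cohomological parameters,
`none` otherwise. (print: Rogawski1990, §12.3 p. 178; Prop. 15.2.1 (b)) -/
def degOneTypeOfXi (ξ : ArchXi) : Option ℤ :=
  if ξ = xiPlus then some 1 else if ξ = xiMinus then some (-1) else none

/-- `ξ⁺_∞ ≠ ξ⁻_∞` — the archimedean half of E2′ `hodgeTypeRigid` (a holomorphic and an antiholomorphic class cannot
lie in the same global A-packet). [cite: Rogawski1990, §15.3 ¶1] -/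
theorem xiPlus_ne_xiMinus : xiPlus ≠ xiMinus := by decide

/-- The two cohomological parameters carry opposite degree-one types. [cite: Rogawski1990, Prop. 15.2.1 (b)] -/
theorem degOneTypeOfXi_values : degOneTypeOfXi xiPlus = some 1 ∧ degOneTypeOfXi xiMinus = some (-1) := by
  refine ⟨by simp [degOneTypeOfXi], ?_⟩
  simp [degOneTypeOfXi, xiPlus, xiMinus]


/-! ## §2 Registered stubs of edition 2 (the line's named intermediate lemmas) — ALL ★-FOLDED since edition 3: T6d, T3j, T6g, T6r, T6k (+ T6e below) -/

section Stubs

variable {α β : Type*} [Fintype α] [DecidableEq α] [Fintype β] [DecidableEq β]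

/-- T6d (generic `U(α,β)`; size M; edition-1∕2 STUB, edition-2.1 ★ THEOREM — by-name fold below; BW 0 §2.4–2.5 ∕ II 3.4 (1)) — **the admissibility bridge**: a
`(𝔤, K)`-module (`IsGKModule`: every vector `K`-finite, `K` acting weakly continuously) that is admissible in the
tree's `Hom_K(τ, V)`-sense (`IsAdmissibleGK`, irreducible `τ`) is admissible AS `K`-MODULE in Borel–Wallach's sense
(`IsKAdmissible`: every `V_{(W)}`, `W` finite-dimensional, is finite-dimensional) — complete reducibility of the
locally finite weakly continuous action of the compact `K = U(α) × U(β)`.  With the tree's ★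
`moduleFinite_gkComplex_carrier_of_isKAdmissible` this makes every `C^q(𝔤, K; V)` finite-dimensional
(`cochainsFinite_of_T6d` below), the standing hypothesis of II 4.5 (`upq_finrank_gkCohomology_eq_sum_typeClasses`).
Why it might fail: `IsAdmissibleGK` quantifies over irreducible `τ` of the ABSTRACT group `K`; the bridge needs the
`K`-finite vectors of `V` to be a sum of irreducibles, which uses `weaklyContinuous` + compactness of `K` — UNFOUNDED:
the ★ closer uses neither (left exactness of `Hom_K(−, V)` + induction on `dim W`, any group `K`; `IsGKModule` idle).
(print: BorelWallach2000, 0 §2.4–2.5, II Prop. 3.4 (1)) -/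
def StubT6dAdmissibleBridge : Prop :=
  ∀ (α β : Type) [Fintype α] [DecidableEq α] [Fintype β] [DecidableEq β]
    (V : Type) [AddCommGroup V] [Module ℂ V]
    (ρK : Representation ℂ (uFormGroup α β).maximalCompact V) (ρ𝔤 : (uFormGroup α β).lie →ₗ⁅ℝ⁆ Module.End ℂ V),
    IsGKModule (uFormGroup α β) ρK ρ𝔤 → IsAdmissibleGK ρK → IsKAdmissible ρK

/-- ★ T6d holds — edition-2.1 by-name fold of `…Cruxes.H413.F0P3bStubT6dAdmissibleBridge.stubT6d_holds` (A-p12 (g12),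
p794411; its type is the def body `StubT6dAdmissibleBridge` binder for binder; no `sorry` behind it; the proof needs no complete
reducibility — left exactness of `Hom_K(−, V)` + induction on `dim W`). [cite: BorelWallach2000, 0 §2.4–2.5, II Prop. 3.4 (1)] -/
theorem stub_T6d_admissibleBridge : StubT6dAdmissibleBridge :=
  F0P3bStubT6dAdmissibleBridge.stubT6d_holds


/-- T3j (generic `U(α,β)`; edition-1 STUB, edition-2 ★ THEOREM — by-name fold of
`…Cruxes.H413.F0P3bStubT3jCocycleValuesPNull.stubT3j_holds`, A-p09 (g18), p793345, whose type is this def body binder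
for binder with `IsPNull` `δ`-unfolded; the junction lemma) — **the values of a closed `(𝔤, K)`-1-cochain of type
`δ = ±1` are `𝔭^{−δ}`-null**: if `f ∈ C¹_δ(𝔲(α,β), K; V)`, `δ² = 1`, `df = 0`, then for every `Y`,
`ρ𝔤(x_s) f(Y) + δ i ρ𝔤(⁅z₀, x_s⁆) f(Y) = 0` on the `𝔭`-frame (cocycle identity `ρ(X)f(Y) = ρ(Y)f(X)` on `𝔭 × 𝔭`
plus `f(⁅z₀, X⁆) = δ i f(X)`).  This is the representation-theoretic half of "holomorphic `1`-forms ↔ `J⁺`"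
[Rogawski1990 §15.2 proof of 15.2.1; BorelWallach2000 II §4.2]: type-`(1,0)` classes are carried by
`𝔭⁻`-primitive vectors of `K`-type `𝔭⁺`. (print: BorelWallach2000, II §4.2 (3); Rogawski1990, §15.2) -/
def StubT3jCocycleValuesPNull : Prop :=
  ∀ (α β : Type) [Fintype α] [DecidableEq α] [Fintype β] [DecidableEq β]
    (V : Type) [AddCommGroup V] [Module ℂ V]
    (ρK : Representation ℂ (uFormGroup α β).maximalCompact V) (ρ𝔤 : (uFormGroup α β).lie →ₗ⁅ℝ⁆ Module.End ℂ V)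
    (hV : ∀ (k : (uFormGroup α β).maximalCompact) (X : (uFormGroup α β).lie), ρK k ∘ₗ ρ𝔤 X ∘ₗ ρK k⁻¹ =
      ρ𝔤 ((uFormGroup α β).Ad (Subgroup.inclusion (uFormGroup α β).maximalCompact_le_carrier k) X))
    (δ : ℤ), δ * δ = 1 →
    ∀ (f : Cochain ℝ (uFormGroup α β).lie (GKCarrier (uFormGroup α β) ρ𝔤) 1),
      f ∈ upqType ρK ρ𝔤 hV 1 δ → d ℝ (uFormGroup α β).lie (GKCarrier (uFormGroup α β) ρ𝔤) 1 f = 0 →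
      ∀ Y : Fin 1 → (uFormGroup α β).lie, IsPNull ρ𝔤 δ (f Y)

theorem stub_T3j_cocycleValuesPNull : StubT3jCocycleValuesPNull :=
  F0P3bStubT3jCocycleValuesPNull.stubT3j_holds

/-- STUB T6g (generic `U(α,β)`; size M–L; NEW in edition 2 — the «lowest `K`-type generates» lemma) — **`𝔭^{−δ}`-null
generation and the `z₀`-grading**: let `V` be an IRREDUCIBLE `(𝔤, K)`-module of `U(α, β)` (only `Ad`-compatibility
`hV` and `IsIrreducibleGK` are used — no admissibility, no unitarity, no `K`-finiteness) and `f ≠ 0` a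
`(𝔤, K)`-1-cochain of type `δ = ±1` whose values are `𝔭^{−δ}`-null (`IsPNull`; = STUB T3j for a cocycle).  Then
`W := span_ℂ {f(X)}` is `K`-stable (`K`-fixedness of `f`), `𝔨`-stable (`θ_Y f = 0`), killed by `𝔭^{−δ}` and of
`z₀`-weight `δ i` (type), so `Σ_k ρ(𝔭^{δ})^k W` is a non-zero `(𝔤, K)`-submodule (`[𝔭^δ, 𝔭^δ] = 0`,
`[𝔭^{−δ}, 𝔭^{δ}] ⊆ 𝔨_ℂ`, `[𝔨, 𝔭^{±}] ⊆ 𝔭^{±}`: PBW reordering with `ρ(Y^{±}) = ½(ρ(Y) ∓ i ρ(⁅z₀, Y⁆))`), hence ALL of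
`V`, graded by the `z₀`-eigenvalues `δ(k+1) i`, `k ≥ 0`, with degree-`0` piece `W`.  CONCLUSIONS typed: (1) every
`z₀`-eigenvalue on `V` is `δ(k+1)·i` for some `k : ℕ`; (2) the `δ i`-eigenspace of `z₀` lies in `W`.  This is the
representation-theoretic core of «`J^± = J_{1,0}, J_{0,1}` are LADDER representations generated by their lowest
`K`-type `𝔭^±`» [BorelWallach2000 VI 4.11 (9)–(11); Kovacevic2021 `ladderPlus`], and exactly what T6a ∕ T6b consume.
Why it might fail: only if the PBW reordering over the REAL form is mis-set (the operators `ρ(Y^±)` live in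
`End_ℂ V`, not in `ρ(𝔤)`); the grading needs `ad z₀ = ±i` on `𝔭^±` (`lie_upqZ0_upqUnit`) and `ad z₀ = 0` on `𝔨`.
(print: BorelWallach2000, II §4.1, VI Thm. 4.11; KnappVogan1995, §IV.11 (lowest `K`-types)) -/
def StubT6gPNullGeneration : Prop :=
  ∀ (α β : Type) [Fintype α] [DecidableEq α] [Fintype β] [DecidableEq β]
    (V : Type) [AddCommGroup V] [Module ℂ V]
    (ρK : Representation ℂ (uFormGroup α β).maximalCompact V) (ρ𝔤 : (uFormGroup α β).lie →ₗ⁅ℝ⁆ Module.End ℂ V)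
    (hV : ∀ (k : (uFormGroup α β).maximalCompact) (X : (uFormGroup α β).lie), ρK k ∘ₗ ρ𝔤 X ∘ₗ ρK k⁻¹ =
      ρ𝔤 ((uFormGroup α β).Ad (Subgroup.inclusion (uFormGroup α β).maximalCompact_le_carrier k) X)),
    IsIrreducibleGK ρK ρ𝔤 →
    ∀ (δ : ℤ), δ = 1 ∨ δ = -1 →
    ∀ (f : Cochain ℝ (uFormGroup α β).lie (GKCarrier (uFormGroup α β) ρ𝔤) 1),
      f ∈ upqType ρK ρ𝔤 hV 1 δ → f ≠ 0 → (∀ Y : Fin 1 → (uFormGroup α β).lie, IsPNull ρ𝔤 δ (f Y)) →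
      (∀ (μ : ℂ) (v : GKCarrier (uFormGroup α β) ρ𝔤), v ≠ 0 → ρ𝔤 (upqZ0 α β) v = μ • v →
          ∃ k : ℕ, μ = ((δ * ((k : ℤ) + 1) : ℤ) : ℂ) * Complex.I) ∧
      (∀ v : GKCarrier (uFormGroup α β) ρ𝔤, ρ𝔤 (upqZ0 α β) v = ((δ : ℂ) * Complex.I) • v →
          v ∈ Submodule.span ℂ (Set.range fun X : (uFormGroup α β).lie => f ![X]))

theorem stub_T6g_pNullGeneration : StubT6gPNullGeneration :=
  F0P3bStubT6gPNullGeneration.stubT6g_holds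

/-- STUB T6r (generic `U(α,β)`; size M–L; NEW in edition 2 — rigidity from the generating datum) — **two irreducible
`(𝔤, K)`-modules of `U(α, β)` carrying non-zero `𝔭^{−δ}`-null `(𝔤, K)`-1-cochains `f`, `f′` of the same type
`δ = ±1` WITH THE SAME KERNEL `{X | f(X) = 0} = {X | f′(X) = 0}` are `(𝔤, K)`-equivalent.**  Proof line: the real
kernel determines the `K`-module `W = span_ℂ f(𝔤) ≅ 𝔭_ℂ ∕ ker f_ℂ` (`f_ℂ(X + iY) = f(X + δ⁅z₀, Y⁆)` on `𝔭`, from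
`f(⁅z₀, X⁆) = δ i f(X)`), so `φ : f(X) ↦ f′(X)` is a well-defined `K`- and `𝔨`-equivariant bijection `W ≅ W′`; the
`(𝔤, K)`-submodule `D` of `V ⊕ V′` generated by the graph of `φ` is `Σ_k ρ(𝔭^δ)^k graph(φ)` (T6g's reordering),
`z₀`-graded (weights `δ(k+1)i`) with degree-`0` piece `graph(φ)`; both projections `D → V`, `D → V′` are
non-zero hence onto (irreducibility).  Injectivity of `D → V`: its kernel `0 ⊕ U′` is a `z₀`-stable, hence GRADED,
`(𝔤, K)`-submodule; `U′_0 ⊆ graph(φ) ∩ (0 ⊕ V′) = 0`, so if `U′ ≠ 0` its lowest piece `U′_m`, `m ≥ 1`, is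
`𝔭^{−δ}`-null, `K`- and `𝔨`-stable of weight `δ(m+1)i` and (the SAME generation lemma as T6g, for a null `K`-`𝔨`-stable
subspace instead of `span f(𝔤)` — provers: land it ONCE, generically, and import it in both closers) generates `V′`
with weights `δ(m+1+k)i`, `k ≥ 0` — but `f′(Y) ≠ 0` has weight `δ i`: contradiction.  So `V ≅ D ≅ V′`.  (The
uniqueness half of «the irreducible quotient of `U(𝔤) ⊗_{𝔨 + 𝔭^{−δ}} W` is unique», stated without Verma modules.)
Consumed by T6c with T6k (1).  Why it might fail: a `z₀`-stable subspace of the graded `D` must be shown GRADED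
(every element is a finite sum of eigenvectors with distinct eigenvalues — Lagrange interpolation in `ρ(z₀)`), the
one delicate step; and `φ` must be checked well defined from the equality of the REAL kernels (`ker f = 𝔨 ⊕ N`).
(print: BorelWallach2000, VI Thm. 4.11 (1); KnappVogan1995, Cor. 2.78; VoganZuckerman1984, Thm. 5.6) -/
def StubT6rPNullRigidity : Prop :=
  ∀ (α β : Type) [Fintype α] [DecidableEq α] [Fintype β] [DecidableEq β]
    (V : Type) [AddCommGroup V] [Module ℂ V]
    (ρK : Representation ℂ (uFormGroup α β).maximalCompact V) (ρ𝔤 : (uFormGroup α β).lie →ₗ⁅ℝ⁆ Module.End ℂ V)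
    (hV : ∀ (k : (uFormGroup α β).maximalCompact) (X : (uFormGroup α β).lie), ρK k ∘ₗ ρ𝔤 X ∘ₗ ρK k⁻¹ =
      ρ𝔤 ((uFormGroup α β).Ad (Subgroup.inclusion (uFormGroup α β).maximalCompact_le_carrier k) X))
    (V' : Type) [AddCommGroup V'] [Module ℂ V']
    (ρK' : Representation ℂ (uFormGroup α β).maximalCompact V') (ρ𝔤' : (uFormGroup α β).lie →ₗ⁅ℝ⁆ Module.End ℂ V')
    (hV' : ∀ (k : (uFormGroup α β).maximalCompact) (X : (uFormGroup α β).lie), ρK' k ∘ₗ ρ𝔤' X ∘ₗ ρK' k⁻¹ =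
      ρ𝔤' ((uFormGroup α β).Ad (Subgroup.inclusion (uFormGroup α β).maximalCompact_le_carrier k) X)),
    IsIrreducibleGK ρK ρ𝔤 → IsIrreducibleGK ρK' ρ𝔤' →
    ∀ (δ : ℤ), δ = 1 ∨ δ = -1 →
    ∀ (f : Cochain ℝ (uFormGroup α β).lie (GKCarrier (uFormGroup α β) ρ𝔤) 1)
      (f' : Cochain ℝ (uFormGroup α β).lie (GKCarrier (uFormGroup α β) ρ𝔤') 1),
      f ∈ upqType ρK ρ𝔤 hV 1 δ → f' ∈ upqType ρK' ρ𝔤' hV' 1 δ → f ≠ 0 → f' ≠ 0 →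
      (∀ Y : Fin 1 → (uFormGroup α β).lie, IsPNull ρ𝔤 δ (f Y)) →
      (∀ Y : Fin 1 → (uFormGroup α β).lie, IsPNull ρ𝔤' δ (f' Y)) →
      (∀ X : (uFormGroup α β).lie, f ![X] = 0 ↔ f' ![X] = 0) →
      AreGKEquivalent ρK ρ𝔤 ρK' ρ𝔤'

theorem stub_T6r_pNullRigidity : StubT6rPNullRigidity :=
  F0P3bStubT6rPNullRigidity.stubT6r_holds

/-- T6k (`U(2,1)`; size S–M; NEW in edition 2, STUB in ed. 2∕2.1, edition-2.2 ★ THEOREM — by-name fold below — the `𝔭`-geometry of `U(2,1)`) — for ANY pair `(ρK, ρ𝔤)` with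
`Ad`-compatibility and a non-zero `(𝔤, K)`-1-cochain `f` of type `δ = ±1` (not necessarily closed):
**(1) `f(X) = 0 ↔ X ∈ 𝔨`** (`f` vanishes on `𝔨` by horizontality; `K = U(2) × U(1)` acts transitively on the
directions of `𝔭 ≅ ℂ²` (`Ad(A, b) x = A x b̄`), so `f(X) = 0` for one `X ∈ 𝔭 ∖ 0` and `K`-equivariance
`ρK(k) f(X) = f(Ad k X)` would force `f|_𝔭 = 0`); **(2) Schur: a second type-`δ` cochain `g` with values in
`W = span_ℂ f(𝔤)` is a COMPLEX MULTIPLE of `f`** (`f_ℂ : 𝔭^δ ≅ W` is a `K`-isomorphism by (1), `f_ℂ⁻¹ ∘ g_ℂ ∈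
End_K(𝔭^δ) = ℂ` since `𝔭^± ≅ ℂ²` is `K`-irreducible — the commutant of `U(2)` in `M₂(ℂ)` is the scalars).
Consumed by T6b (with T6g) and T6c (with T6r).  Generic `U(α, β)` versions hold (`𝔭^± = ℂ^α ⊗ (ℂ^β)^*` is
`K`-irreducible) but only `U(2,1)` is needed.  Why it might fail: (2) needs `g` to be `K`-EQUIVARIANT into `W` for
the SAME `K`-action — automatic since both are values of `K`-fixed cochains in the same `V`; a `g` of type `−δ` would
break it, hence the same-type hypothesis. (print: BorelWallach2000, II §4.1–4.2; Rogawski1990, §12.3 p. 178) -/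
def StubT6kU21PGeometry : Prop :=
  ∀ (V : Type) [AddCommGroup V] [Module ℂ V]
    (ρK : Representation ℂ (uFormGroup (Fin 2) (Fin 1)).maximalCompact V)
    (ρ𝔤 : (uFormGroup (Fin 2) (Fin 1)).lie →ₗ⁅ℝ⁆ Module.End ℂ V)
    (hV : ∀ (k : (uFormGroup (Fin 2) (Fin 1)).maximalCompact) (X : (uFormGroup (Fin 2) (Fin 1)).lie),
      ρK k ∘ₗ ρ𝔤 X ∘ₗ ρK k⁻¹ =
        ρ𝔤 ((uFormGroup (Fin 2) (Fin 1)).Ad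
          (Subgroup.inclusion (uFormGroup (Fin 2) (Fin 1)).maximalCompact_le_carrier k) X))
    (δ : ℤ), δ = 1 ∨ δ = -1 →
    ∀ (f g : Cochain ℝ (uFormGroup (Fin 2) (Fin 1)).lie (GKCarrier (uFormGroup (Fin 2) (Fin 1)) ρ𝔤) 1),
      f ∈ upqType ρK ρ𝔤 hV 1 δ → g ∈ upqType ρK ρ𝔤 hV 1 δ → f ≠ 0 →
      (∀ X : (uFormGroup (Fin 2) (Fin 1)).lie, f ![X] = 0 ↔ X ∈ (uFormGroup (Fin 2) (Fin 1)).kInLie) ∧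
      ((∀ X : (uFormGroup (Fin 2) (Fin 1)).lie,
          g ![X] ∈ Submodule.span ℂ (Set.range fun Y : (uFormGroup (Fin 2) (Fin 1)).lie => f ![Y])) →
        ∃ c : ℂ, ∀ X : (uFormGroup (Fin 2) (Fin 1)).lie, g ![X] = c • f ![X])

/-- ★ T6k holds — edition-2.2 by-name fold of `…Cruxes.H413.F0P3bStubT6kU21PGeometry.stubT6k_holds` (F0P3-p04 (g2),
p795304; its type is the def body `StubT6kU21PGeometry` binder for binder; no `sorry` behind it; proof by two explicit elements of
`K = U(2) × U(1)` — a phase `kV(phaseDiag 0, 1)` and the 3-4-5 rotation `kV(rotW, 1)` — no transitivity theorem, no abstract Schur).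
[cite: BorelWallach2000, II §4.1–4.2] [cite: Rogawski1990, §12.3 p. 178] -/
theorem stub_T6k_u21PGeometry : StubT6kU21PGeometry :=
  F0P3bStubT6kU21PGeometry.stubT6k_holds

end Stubs

/-! ## §2′ Folded statements of edition 1 (defs VERBATIM from edition 1; theorems now PROVED from §2 ∕ from ★ closers) -/

section Folds

/-! ### Glue lemmas on `(𝔤, K)`-1-cochains of `U(α, β)` (sorry-free) -/

section Glue

variable {α β : Type*} [Fintype α] [DecidableEq α] [Fintype β] [DecidableEq β]
  {V : Type*} [AddCommGroup V] [Module ℂ V]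
  (ρK : Representation ℂ (uFormGroup α β).maximalCompact V)
  (ρ𝔤 : (uFormGroup α β).lie →ₗ⁅ℝ⁆ Module.End ℂ V)
  (hV : ∀ (k : (uFormGroup α β).maximalCompact) (X : (uFormGroup α β).lie), ρK k ∘ₗ ρ𝔤 X ∘ₗ ρK k⁻¹ =
    ρ𝔤 ((uFormGroup α β).Ad (Subgroup.inclusion (uFormGroup α β).maximalCompact_le_carrier k) X))

/-- A `1`-cochain is determined by its values on the `![X]`. [folklore] -/
theorem cochainOne_apply_eq (f : Cochain ℝ (uFormGroup α β).lie (GKCarrier (uFormGroup α β) ρ𝔤) 1)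
    (v : Fin 1 → (uFormGroup α β).lie) : f v = f ![v 0] := by
  congr 1
  funext i
  fin_cases i
  rfl

/-- A `1`-cochain vanishing on every `![X]` is zero. [folklore] -/
theorem cochainOne_eq_zero {f : Cochain ℝ (uFormGroup α β).lie (GKCarrier (uFormGroup α β) ρ𝔤) 1}
    (h : ∀ X : (uFormGroup α β).lie, f ![X] = 0) : f = 0 := by
  refine AlternatingMap.ext fun v => ?_
  rw [cochainOne_apply_eq ρ𝔤 f v, h, AlternatingMap.zero_apply]

/-- A non-zero `1`-cochain has a non-zero value. [folklore] -/
theorem cochainOne_exists_apply_ne_zero {f : Cochain ℝ (uFormGroup α β).lie (GKCarrier (uFormGroup α β) ρ𝔤) 1}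
    (h : f ≠ 0) : ∃ X : (uFormGroup α β).lie, f ![X] ≠ 0 := by
  by_contra hX
  push Not at hX
  exact h (cochainOne_eq_zero ρ𝔤 hX)

/-- **A non-zero class of type `δ` is represented by a non-zero COCYCLE of type `δ`** (unfolding of
`upqTypeClasses = (Z¹ ∩ C¹_δ) ↦ H¹`). [cite: BorelWallach2000, II Thm. 4.8] -/
theorem exists_typeCocycle_of_ne_bot {δ : ℤ} (h : upqTypeClasses ρK ρ𝔤 hV 1 δ ≠ ⊥) :
    ∃ f : Cochain ℝ (uFormGroup α β).lie (GKCarrier (uFormGroup α β) ρ𝔤) 1,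
      f ∈ upqType ρK ρ𝔤 hV 1 δ ∧ d ℝ (uFormGroup α β).lie (GKCarrier (uFormGroup α β) ρ𝔤) 1 f = 0 ∧ f ≠ 0 := by
  obtain ⟨x, hx, hx0⟩ := (Submodule.ne_bot_iff _).1 h
  obtain ⟨z, hz, rfl⟩ := hx
  have hzt : (z : Cochain ℝ (uFormGroup α β).lie (GKCarrier (uFormGroup α β) ρ𝔤) 1) ∈ upqType ρK ρ𝔤 hV 1 δ :=
    Submodule.mem_comap.1 hz
  have hzc := ((gkComplex (uFormGroup α β) ρK ρ𝔤 hV).mem_cocycles_iff 1 _).1 z.2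
  refine ⟨z, hzt, hzc.2, fun hz0 => hx0 ?_⟩
  have : z = 0 := Subtype.ext hz0
  rw [this, map_zero]

/-- **`𝔨`-equivariance of a `(𝔤, K)`-1-cochain**: `f(⁅Y, X⁆) = ρ𝔤(Y) f(X)` for `Y ∈ 𝔨` (`θ_Y f = 0`).
[cite: BorelWallach2000, I §5.1 (2)] -/
theorem gkOne_apply_lie {f : Cochain ℝ (uFormGroup α β).lie (GKCarrier (uFormGroup α β) ρ𝔤) 1}
    (hf : f ∈ (gkComplex (uFormGroup α β) ρK ρ𝔤 hV).carrier 1) {Y : (uFormGroup α β).lie}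
    (hY : Y ∈ (uFormGroup α β).kInLie) (X : (uFormGroup α β).lie) : f ![⁅Y, X⁆] = ρ𝔤 Y (f ![X]) := by
  have h : lieDer ℝ (uFormGroup α β).lie (GKCarrier (uFormGroup α β) ρ𝔤) 1 Y f = 0 :=
    (((mem_gkComplex_succ_iff (uFormGroup α β) ρK ρ𝔤 hV 0 f).1 hf).1 Y hY).1
  have e := congrArg (fun g : Cochain ℝ (uFormGroup α β).lie (GKCarrier (uFormGroup α β) ρ𝔤) 1 => g ![X]) h
  simp only [lieDer_one_apply, AlternatingMap.zero_apply, sub_eq_zero] at e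
  rw [GKCarrier.bracket_def] at e
  exact e.symm

/-- **Horizontality of a `(𝔤, K)`-1-cochain**: `f(X) = 0` for `X ∈ 𝔨` (`i_X f = 0`). [cite: BorelWallach2000, I §5.1 (2)] -/
theorem gkOne_apply_of_mem_kInLie {f : Cochain ℝ (uFormGroup α β).lie (GKCarrier (uFormGroup α β) ρ𝔤) 1}
    (hf : f ∈ (gkComplex (uFormGroup α β) ρK ρ𝔤 hV).carrier 1) {X : (uFormGroup α β).lie}
    (hX : X ∈ (uFormGroup α β).kInLie) : f ![X] = 0 := by
  have h := (((mem_gkComplex_succ_iff (uFormGroup α β) ρK ρ𝔤 hV 0 f).1 hf).1 X hX).2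
  have e := congrArg (fun g : Cochain ℝ (uFormGroup α β).lie (GKCarrier (uFormGroup α β) ρ𝔤) 0 => g ![]) h
  simpa only [ins_apply, AlternatingMap.zero_apply] using e

/-- Additivity of a `1`-cochain in its single argument. [folklore] -/
theorem cochainOne_apply_add (f : Cochain ℝ (uFormGroup α β).lie (GKCarrier (uFormGroup α β) ρ𝔤) 1)
    (x y : (uFormGroup α β).lie) : f ![x + y] = f ![x] + f ![y] := by
  have h := congrArg (fun g : Cochain ℝ (uFormGroup α β).lie (GKCarrier (uFormGroup α β) ρ𝔤) 0 => g ![])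
    (ins_add 0 x y f)
  simpa only [ins_apply, AlternatingMap.add_apply] using h

/-- **Degree-one types are `±1` only**: a `(𝔤, K)`-1-cochain of type `δ` with `δ² ≠ 1` vanishes
(`f(J²X) = (δ i)² f(X)` by `𝔨`-equivariance at `z₀` and the type, `= −f(X)` since `J² ≡ −1 mod 𝔨` and `f(𝔨) = 0`).
[cite: BorelWallach2000, II §4.2 (3)] -/
theorem typeOne_eq_zero_of_sq_ne_one {δ : ℤ} (hδ : δ * δ ≠ 1)
    {f : Cochain ℝ (uFormGroup α β).lie (GKCarrier (uFormGroup α β) ρ𝔤) 1} (hf : f ∈ upqType ρK ρ𝔤 hV 1 δ) :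
    f = 0 := by
  obtain ⟨hfc, hft⟩ := (mem_upqType_iff ρK ρ𝔤 hV 1 δ f).1 hf
  refine cochainOne_eq_zero ρ𝔤 fun X => ?_
  have hJ : ∀ Y : (uFormGroup α β).lie, f ![⁅upqZ0 α β, Y⁆] = ((δ : ℂ) * Complex.I) • f ![Y] := fun Y => by
    rw [gkOne_apply_lie ρK ρ𝔤 hV hfc upqZ0_mem_kInLie Y]
    exact hft ![Y]
  have h0 : f ![⁅upqZ0 α β, ⁅upqZ0 α β, X⁆⁆ + X] = 0 :=
    gkOne_apply_of_mem_kInLie ρK ρ𝔤 hV hfc (upq_isComplexStructureElement.lie_lie_add_mem X)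
  rw [cochainOne_apply_add ρ𝔤, hJ, hJ, smul_smul] at h0
  have hI : ((δ : ℂ) * Complex.I) * ((δ : ℂ) * Complex.I) = -((δ * δ : ℤ) : ℂ) := by
    rw [show ((δ : ℂ) * Complex.I) * ((δ : ℂ) * Complex.I) = (δ : ℂ) * (δ : ℂ) * (Complex.I * Complex.I) by ring,
      Complex.I_mul_I]
    push_cast
    ring
  rw [hI, neg_smul, neg_add_eq_sub, sub_eq_zero] at h0
  -- h0 : f ![X] = ((δ * δ : ℤ) : ℂ) • f ![X]
  have h1 : ((1 : ℂ) - ((δ * δ : ℤ) : ℂ)) • f ![X] = 0 := by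
    rw [sub_smul, one_smul, ← h0, sub_self]
  have hne : (1 : ℂ) - ((δ * δ : ℤ) : ℂ) ≠ 0 := by
    rw [sub_ne_zero]
    intro h1
    apply hδ
    exact_mod_cast h1.symm
  exact (smul_eq_zero.1 h1).resolve_left hne

end Glue

/-! ### T6e — FOLDED BY NAME onto the ★ closer `Theorems/F0P3bStubT6eCasimirScalar` (A-p09 (g18), p792178) -/

section T6e

/-- T6e (generic `U(α,β)`; edition-1 STUB, edition-2 ★ THEOREM) — **on an irreducible admissible `(𝔤, K)`-module the
Casimir operator `C_V = upqCasimirOp ρ𝔤` acts by a scalar** (Dixmier–Schur).  Def body VERBATIM from edition 1;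
`stub_T6e_casimirScalar` below is the by-name fold of ★ `…Cruxes.H413.F0P3bStubT6eCasimirScalar.stubT6e_holds` (its
type is this body binder for binder; kernel certificate `A-provers/A-p09/g18/CERT-T6e-token-identity.A-p09g18.lean`).
(print: BorelWallach2000, II §3.1, Cor. 3.3; KnappVogan1995, Cor. 2.78 (Schur)) -/
def StubT6eCasimirScalar : Prop :=
  ∀ (α β : Type) [Fintype α] [DecidableEq α] [Fintype β] [DecidableEq β]
    (V : Type) [AddCommGroup V] [Module ℂ V]
    (ρK : Representation ℂ (uFormGroup α β).maximalCompact V) (ρ𝔤 : (uFormGroup α β).lie →ₗ⁅ℝ⁆ Module.End ℂ V),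
    IsGKModule (uFormGroup α β) ρK ρ𝔤 → IsIrreducibleGK ρK ρ𝔤 → IsAdmissibleGK ρK →
    ∃ c : ℂ, ∀ v : V, upqCasimirOp ρ𝔤 v = c • v

/-- ★ T6e holds (fold by name; no `sorry` behind it). [cite: BorelWallach2000, II §3.1, Cor. 3.3] -/
theorem stub_T6e_casimirScalar : StubT6eCasimirScalar :=
  F0P3bStubT6eCasimirScalar.stubT6e_holds

end T6e

/-! ### T6a ∕ T6b ∕ T6c for `U(2,1)` — DERIVED in edition 2 from T3j + T6g + T6k + T6r (defs VERBATIM from edition 1) -/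

section T6abc

/-- T6a (`U(2,1)`; edition-1 STUB, edition-2 DERIVED from T3j + T6g) — **purity of degree-one cohomology**: an
irreducible unitary `(𝔤, K)`-module of `U(2,1)` does not carry both Hodge types in degree 1.  Proof (`t6a_of`): a
non-zero `(1,0)`-class gives a non-zero closed `(1,0)`-cochain `f` (`exists_typeCocycle_of_ne_bot`) with `𝔭⁻`-null
values (T3j); by T6g every `z₀`-eigenvalue of `V` is then `(k+1)i`, `k ≥ 0`; a non-zero `(0,1)`-cocycle has a non-zero
value of `z₀`-eigenvalue `−i` — contradiction.  (Unitarity and admissibility are NOT used.)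
(print: BorelWallach2000, VI Thm. 4.11; Rogawski1990, Prop. 15.2.1 (b)) -/
def StubT6aDegOneTypePure : Prop :=
  ∀ (V : Type) [AddCommGroup V] [Module ℂ V]
    (ρK : Representation ℂ (uFormGroup (Fin 2) (Fin 1)).maximalCompact V)
    (ρ𝔤 : (uFormGroup (Fin 2) (Fin 1)).lie →ₗ⁅ℝ⁆ Module.End ℂ V) (h : IsCohUnitaryIrrep ρK ρ𝔤),
    upqTypeClasses ρK ρ𝔤 h.gk.ad_compat 1 1 = ⊥ ∨ upqTypeClasses ρK ρ𝔤 h.gk.ad_compat 1 (-1) = ⊥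

/-- T6b (`U(2,1)`; edition-1 STUB, edition-2 DERIVED from T3j + T6g + T6k) — **each degree-one Hodge piece is at most a
complex line**: `H¹_δ(V)` is finite-dimensional of real dimension `≤ 2`.  Proof (`t6b_of`): for `δ² ≠ 1` there are no
type-`δ` 1-cochains (`typeOne_eq_zero_of_sq_ne_one`); for `δ = ±1` and a non-zero type-`δ` cocycle `f₀`, T3j + T6g (2)
put the values of every type-`δ` cocycle `g` in `span_ℂ f₀(𝔤)` (they are `δ i`-eigenvectors of `z₀`), and T6k (2)
makes `g = c • f₀`; so the type-`δ` cocycles sit in the real plane `ℂ • f₀` and so do their classes.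
(print: BorelWallach2000, VI Thm. 4.11 (3); Rogawski1990, Prop. 15.2.1 (b)) -/
def StubT6bDegOneTypeFinrank : Prop :=
  ∀ (V : Type) [AddCommGroup V] [Module ℂ V]
    (ρK : Representation ℂ (uFormGroup (Fin 2) (Fin 1)).maximalCompact V)
    (ρ𝔤 : (uFormGroup (Fin 2) (Fin 1)).lie →ₗ⁅ℝ⁆ Module.End ℂ V) (h : IsCohUnitaryIrrep ρK ρ𝔤) (δ : ℤ),
    Module.Finite ℝ ↥(upqTypeClasses ρK ρ𝔤 h.gk.ad_compat 1 δ) ∧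
      Module.finrank ℝ ↥(upqTypeClasses ρK ρ𝔤 h.gk.ad_compat 1 δ) ≤ 2

/-- T6c (`U(2,1)`; edition-1 STUB (the hardest), edition-2 DERIVED from T3j + T6k + T6r) — **rigidity of the degree-one
classes**: two irreducible unitary `(𝔤, K)`-modules of `U(2,1)` with non-zero degree-one cohomology of the same type
`δ ∈ {±1}` are `(𝔤, K)`-equivalent (both are `J⁺`, resp. `J⁻`).  Proof (`t6c_of`): non-zero classes give non-zero
type-`δ` cocycles `f`, `f′` (values `𝔭^{−δ}`-null by T3j) whose kernels are both `𝔨` (T6k (1)); T6r.  The Kovačević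
NECESSITY classification (surv3 gap G2) and the complexification transport (G3) are NO LONGER on this path.
(print: BorelWallach2000, VI Thm. 4.11 (1); Rogawski1990, Prop. 15.2.1 (b); VoganZuckerman1984, Thm. 5.6) -/
def StubT6cDegOneTypeRigid : Prop :=
  ∀ (V : Type) [AddCommGroup V] [Module ℂ V]
    (ρK : Representation ℂ (uFormGroup (Fin 2) (Fin 1)).maximalCompact V)
    (ρ𝔤 : (uFormGroup (Fin 2) (Fin 1)).lie →ₗ⁅ℝ⁆ Module.End ℂ V) (h : IsCohUnitaryIrrep ρK ρ𝔤)
    (V' : Type) [AddCommGroup V'] [Module ℂ V']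
    (ρK' : Representation ℂ (uFormGroup (Fin 2) (Fin 1)).maximalCompact V')
    (ρ𝔤' : (uFormGroup (Fin 2) (Fin 1)).lie →ₗ⁅ℝ⁆ Module.End ℂ V') (h' : IsCohUnitaryIrrep ρK' ρ𝔤')
    (δ : ℤ), δ = 1 ∨ δ = -1 →
    upqTypeClasses ρK ρ𝔤 h.gk.ad_compat 1 δ ≠ ⊥ → upqTypeClasses ρK' ρ𝔤' h'.gk.ad_compat 1 δ ≠ ⊥ →
    AreGKEquivalent ρK ρ𝔤 ρK' ρ𝔤'

/-- **T6a from T3j + T6g** (kernel-checked composition). [cite: BorelWallach2000, VI Thm. 4.11 (9),(11)] -/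
theorem t6a_of (h3j : StubT3jCocycleValuesPNull) (h6g : StubT6gPNullGeneration) : StubT6aDegOneTypePure := by
  intro V _ _ ρK ρ𝔤 h
  by_contra hboth
  obtain ⟨hp, hm⟩ := not_or.1 hboth
  obtain ⟨f, hf, hdf, hf0⟩ := exists_typeCocycle_of_ne_bot ρK ρ𝔤 h.gk.ad_compat hp
  obtain ⟨g, hg, -, hg0⟩ := exists_typeCocycle_of_ne_bot ρK ρ𝔤 h.gk.ad_compat hm
  have hfN := h3j (Fin 2) (Fin 1) V ρK ρ𝔤 h.gk.ad_compat 1 (by norm_num) f hf hdf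
  obtain ⟨hspec, -⟩ := h6g (Fin 2) (Fin 1) V ρK ρ𝔤 h.gk.ad_compat h.irred 1 (Or.inl rfl) f hf hf0 hfN
  obtain ⟨X, hX⟩ := cochainOne_exists_apply_ne_zero ρ𝔤 hg0
  have hev := ((mem_upqType_iff ρK ρ𝔤 h.gk.ad_compat 1 (-1) g).1 hg).2 ![X]
  obtain ⟨k, hk⟩ := hspec _ (g ![X]) hX hev
  have hk' : ((-1 : ℤ) : ℂ) = (((1 : ℤ) * ((k : ℤ) + 1) : ℤ) : ℂ) := mul_right_cancel₀ Complex.I_ne_zero hk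
  have hk'' : (-1 : ℤ) = 1 * ((k : ℤ) + 1) := by exact_mod_cast hk'
  omega

/-- **T6c from T3j + T6k (1) + T6r** (kernel-checked composition). [cite: BorelWallach2000, VI Thm. 4.11 (1)] -/
theorem t6c_of (h3j : StubT3jCocycleValuesPNull) (h6k : StubT6kU21PGeometry) (h6r : StubT6rPNullRigidity) :
    StubT6cDegOneTypeRigid := by
  intro V _ _ ρK ρ𝔤 h V' _ _ ρK' ρ𝔤' h' δ hδ hne hne'
  have hδ2 : δ * δ = 1 := by rcases hδ with rfl | rfl <;> norm_num
  obtain ⟨f, hf, hdf, hf0⟩ := exists_typeCocycle_of_ne_bot ρK ρ𝔤 h.gk.ad_compat hne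
  obtain ⟨f', hf', hdf', hf0'⟩ := exists_typeCocycle_of_ne_bot ρK' ρ𝔤' h'.gk.ad_compat hne'
  have hN := h3j (Fin 2) (Fin 1) V ρK ρ𝔤 h.gk.ad_compat δ hδ2 f hf hdf
  have hN' := h3j (Fin 2) (Fin 1) V' ρK' ρ𝔤' h'.gk.ad_compat δ hδ2 f' hf' hdf'
  have hk := (h6k V ρK ρ𝔤 h.gk.ad_compat δ hδ f f hf hf hf0).1
  have hk' := (h6k V' ρK' ρ𝔤' h'.gk.ad_compat δ hδ f' f' hf' hf' hf0').1
  exact h6r (Fin 2) (Fin 1) V ρK ρ𝔤 h.gk.ad_compat V' ρK' ρ𝔤' h'.gk.ad_compat h.irred h'.irred δ hδ f f' hf hf'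
    hf0 hf0' hN hN' fun X => (hk X).trans (hk' X).symm

/-- **One complex line of type-`δ` cochains** (`U(2,1)`, `δ = ±1`): given a non-zero CLOSED type-`δ` cochain `f₀`
of an irreducible `V`, every type-`δ` `(𝔤, K)`-1-cochain is a complex multiple of `f₀` — T3j (values of `f₀` are
`𝔭^{−δ}`-null) + T6g (2) (the `δ i`-eigenvectors of `z₀` lie in `span_ℂ f₀(𝔤)`) + T6k (2) (Schur).
[cite: BorelWallach2000, VI Thm. 4.11 (3)] -/
theorem typeOne_eq_smul_of (h3j : StubT3jCocycleValuesPNull) (h6g : StubT6gPNullGeneration)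
    (h6k : StubT6kU21PGeometry) {V : Type} [AddCommGroup V] [Module ℂ V]
    (ρK : Representation ℂ (uFormGroup (Fin 2) (Fin 1)).maximalCompact V)
    (ρ𝔤 : (uFormGroup (Fin 2) (Fin 1)).lie →ₗ⁅ℝ⁆ Module.End ℂ V) (h : IsCohUnitaryIrrep ρK ρ𝔤)
    {δ : ℤ} (hδ : δ = 1 ∨ δ = -1)
    {f₀ : Cochain ℝ (uFormGroup (Fin 2) (Fin 1)).lie (GKCarrier (uFormGroup (Fin 2) (Fin 1)) ρ𝔤) 1}
    (hf₀t : f₀ ∈ upqType ρK ρ𝔤 h.gk.ad_compat 1 δ)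
    (hd₀ : d ℝ (uFormGroup (Fin 2) (Fin 1)).lie (GKCarrier (uFormGroup (Fin 2) (Fin 1)) ρ𝔤) 1 f₀ = 0) (hf₀0 : f₀ ≠ 0)
    {g : Cochain ℝ (uFormGroup (Fin 2) (Fin 1)).lie (GKCarrier (uFormGroup (Fin 2) (Fin 1)) ρ𝔤) 1}
    (hgt : g ∈ upqType ρK ρ𝔤 h.gk.ad_compat 1 δ) : ∃ c : ℂ, g = c • f₀ := by
  have hδ2 : δ * δ = 1 := by rcases hδ with rfl | rfl <;> norm_num
  have hN := h3j (Fin 2) (Fin 1) V ρK ρ𝔤 h.gk.ad_compat δ hδ2 f₀ hf₀t hd₀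
  obtain ⟨-, hW⟩ := h6g (Fin 2) (Fin 1) V ρK ρ𝔤 h.gk.ad_compat h.irred δ hδ f₀ hf₀t hf₀0 hN
  have hgv := ((mem_upqType_iff ρK ρ𝔤 h.gk.ad_compat 1 δ g).1 hgt).2
  have hvals : ∀ X : (uFormGroup (Fin 2) (Fin 1)).lie,
      g ![X] ∈ Submodule.span ℂ (Set.range fun Y : (uFormGroup (Fin 2) (Fin 1)).lie => f₀ ![Y]) :=
    fun X => hW (g ![X]) (hgv ![X])
  obtain ⟨c, hc⟩ := (h6k V ρK ρ𝔤 h.gk.ad_compat δ hδ f₀ g hf₀t hgt hf₀0).2 hvals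
  refine ⟨c, sub_eq_zero.1 (cochainOne_eq_zero ρ𝔤 fun X => ?_)⟩
  rw [AlternatingMap.sub_apply, AlternatingMap.smul_apply, hc X, sub_self]

/-- **T6b from T3j + T6g (2) + T6k (2)** (kernel-checked composition): the type-`δ` cocycles `Z¹_δ` sit in the real
plane `ℂ • f₀` (or vanish: `δ² ≠ 1`, or no non-zero cocycle), hence so do their classes `H¹_δ = [Z¹_δ]`.
[cite: BorelWallach2000, VI Thm. 4.11 (3)] -/
theorem t6b_of (h3j : StubT3jCocycleValuesPNull) (h6g : StubT6gPNullGeneration) (h6k : StubT6kU21PGeometry) :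
    StubT6bDegOneTypeFinrank := by
  intro V _ _ ρK ρ𝔤 h δ
  -- `Z = Z¹_δ ≤ Z¹` (an `ℝ`-submodule of the cocycles); `H¹_δ = Z.map [·]` by definition of `upqTypeClasses`
  obtain ⟨Z, hZ⟩ : ∃ Z : Submodule ℝ ↥((gkComplex (uFormGroup (Fin 2) (Fin 1)) ρK ρ𝔤 h.gk.ad_compat).cocycles 1),
      Z = (upqType ρK ρ𝔤 h.gk.ad_compat 1 δ).comap ((gkComplex (uFormGroup (Fin 2) (Fin 1)) ρK ρ𝔤 h.gk.ad_compat).cocycles 1).subtype := ⟨_, rfl⟩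
  have hcl : upqTypeClasses ρK ρ𝔤 h.gk.ad_compat 1 δ = Z.map ((gkComplex (uFormGroup (Fin 2) (Fin 1)) ρK ρ𝔤 h.gk.ad_compat).toCohomology 1) := by
    rw [hZ]
    rfl
  have hmemZ : ∀ z : ↥((gkComplex (uFormGroup (Fin 2) (Fin 1)) ρK ρ𝔤 h.gk.ad_compat).cocycles 1), z ∈ Z ↔ (z : Cochain ℝ (uFormGroup (Fin 2) (Fin 1)).lie (GKCarrier (uFormGroup (Fin 2) (Fin 1)) ρ𝔤) 1) ∈ upqType ρK ρ𝔤 h.gk.ad_compat 1 δ := fun z => by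
    rw [hZ, Submodule.mem_comap, Submodule.coe_subtype]
  rw [hcl]
  suffices hfin : Module.Finite ℝ ↥Z ∧ Module.finrank ℝ ↥Z ≤ 2 by
    haveI := hfin.1
    exact ⟨Module.Finite.of_surjective (((gkComplex (uFormGroup (Fin 2) (Fin 1)) ρK ρ𝔤 h.gk.ad_compat).toCohomology 1).submoduleMap Z)
        (LinearMap.submoduleMap_surjective _ Z), (Submodule.finrank_map_le _ Z).trans hfin.2⟩
  by_cases hex : ∃ z ∈ Z, (z : Cochain ℝ (uFormGroup (Fin 2) (Fin 1)).lie (GKCarrier (uFormGroup (Fin 2) (Fin 1)) ρ𝔤) 1) ≠ 0 ∧ (δ = 1 ∨ δ = -1)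
  · obtain ⟨z₀, hz₀, hz₀0, hδ⟩ := hex
    have hf₀t : (z₀ : Cochain ℝ (uFormGroup (Fin 2) (Fin 1)).lie (GKCarrier (uFormGroup (Fin 2) (Fin 1)) ρ𝔤) 1) ∈ upqType ρK ρ𝔤 h.gk.ad_compat 1 δ := (hmemZ z₀).1 hz₀
    have hd₀ : d ℝ (uFormGroup (Fin 2) (Fin 1)).lie (GKCarrier (uFormGroup (Fin 2) (Fin 1)) ρ𝔤) 1 (z₀ : Cochain ℝ (uFormGroup (Fin 2) (Fin 1)).lie (GKCarrier (uFormGroup (Fin 2) (Fin 1)) ρ𝔤) 1) = 0 :=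
      (((gkComplex (uFormGroup (Fin 2) (Fin 1)) ρK ρ𝔤 h.gk.ad_compat).mem_cocycles_iff 1 _).1 z₀.2).2
    -- the real plane `ℂ • f₀ ⊆ C¹` as the range of an `ℝ`-linear map `ℂ → C¹`
    let Φ : ℂ →ₗ[ℝ] Cochain ℝ (uFormGroup (Fin 2) (Fin 1)).lie (GKCarrier (uFormGroup (Fin 2) (Fin 1)) ρ𝔤) 1 :=
      (LinearMap.toSpanSingleton ℂ (Cochain ℝ (uFormGroup (Fin 2) (Fin 1)).lie (GKCarrier (uFormGroup (Fin 2) (Fin 1)) ρ𝔤) 1) (z₀ : Cochain ℝ (uFormGroup (Fin 2) (Fin 1)).lie (GKCarrier (uFormGroup (Fin 2) (Fin 1)) ρ𝔤) 1)).restrictScalars ℝ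
    have hle : Z.map ((gkComplex (uFormGroup (Fin 2) (Fin 1)) ρK ρ𝔤 h.gk.ad_compat).cocycles 1).subtype ≤ LinearMap.range Φ := by
      rintro g ⟨z, hz, rfl⟩
      obtain ⟨c, hc⟩ := typeOne_eq_smul_of h3j h6g h6k ρK ρ𝔤 h hδ hf₀t hd₀ hz₀0 ((hmemZ z).1 hz)
      refine ⟨c, ?_⟩
      rw [LinearMap.restrictScalars_apply, LinearMap.toSpanSingleton_apply, Submodule.coe_subtype]
      exact hc.symm
    have h2 : Module.finrank ℝ ↥(LinearMap.range Φ) ≤ 2 :=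
      (LinearMap.finrank_range_le Φ).trans_eq Complex.finrank_real_complex
    haveI : Module.Finite ℝ ↥(Z.map ((gkComplex (uFormGroup (Fin 2) (Fin 1)) ρK ρ𝔤 h.gk.ad_compat).cocycles 1).subtype) := Submodule.finiteDimensional_of_le hle
    have e : ↥Z ≃ₗ[ℝ] ↥(Z.map ((gkComplex (uFormGroup (Fin 2) (Fin 1)) ρK ρ𝔤 h.gk.ad_compat).cocycles 1).subtype) :=
      Submodule.equivMapOfInjective _ (Submodule.injective_subtype _) Z
    exact ⟨Module.Finite.equiv e.symm, (LinearEquiv.finrank_eq e).trans_le ((Submodule.finrank_mono hle).trans h2)⟩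
  · -- no non-zero type-`δ` cocycle with `δ = ±1`: `Z = ⊥` (for `δ² ≠ 1` by `typeOne_eq_zero_of_sq_ne_one`)
    have hZ0 : Z = ⊥ := by
      rw [Submodule.eq_bot_iff]
      intro z hz
      by_contra hz0
      have hz0' : (z : Cochain ℝ (uFormGroup (Fin 2) (Fin 1)).lie (GKCarrier (uFormGroup (Fin 2) (Fin 1)) ρ𝔤) 1) ≠ 0 := fun h0 => hz0 (Subtype.ext h0)
      have hsq : δ * δ = 1 := by
        by_contra hsq
        exact hz0' (typeOne_eq_zero_of_sq_ne_one ρK ρ𝔤 h.gk.ad_compat hsq ((hmemZ z).1 hz))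
      exact hex ⟨z, hz, hz0', Int.eq_one_or_neg_one_of_mul_eq_one hsq⟩
    rw [hZ0]
    exact ⟨inferInstance, by rw [finrank_bot]; norm_num⟩

/-- **T6a holds OUTRIGHT since edition 3** (T3j ★, T6g ★ p796658; kernel axioms trio). [cite: Rogawski1990, Prop. 15.2.1 (b)] -/
theorem stub_T6a_degOneTypePure : StubT6aDegOneTypePure :=
  t6a_of stub_T3j_cocycleValuesPNull stub_T6g_pNullGeneration

/-- **T6a, the DIRECT road** (F0P3-p01 (g2), ★ p796166 `Theorems/F0P3bStubT6aDegOneTypePure`: `typeClasses_one_eq_bot_or` for every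
irreducible `(𝔤, K)`-module, via the weight tower; no T6g). [cite: Rogawski1990, Prop. 15.2.1 (b)] -/
theorem t6a_direct : StubT6aDegOneTypePure :=
  fun V _ _ ρK ρ𝔤 h => F0P3bStubT6aDegOneTypePure.stubT6a_holds V ρK ρ𝔤 h.gk h.irred

/-- **T6b holds OUTRIGHT since edition 3** (T3j ★, T6k ★ ed. 2.2, T6g ★ ed. 3; kernel axioms trio). [cite: Rogawski1990, Prop. 15.2.1 (b)] -/
theorem stub_T6b_degOneTypeFinrank : StubT6bDegOneTypeFinrank :=
  t6b_of stub_T3j_cocycleValuesPNull stub_T6g_pNullGeneration stub_T6k_u21PGeometry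

/-- **T6c holds OUTRIGHT since edition 3** (was the hardest stub of edition 1; T3j ★, T6k ★ ed. 2.2, T6r ★ ed. 3; kernel axioms `propext ∕ Classical.choice ∕ Quot.sound`). [cite: Rogawski1990, Prop. 15.2.1 (b)] -/
theorem stub_T6c_degOneTypeRigid : StubT6cDegOneTypeRigid :=
  t6c_of stub_T3j_cocycleValuesPNull stub_T6k_u21PGeometry stub_T6r_pNullRigidity

end T6abc

end Folds

/-! ## §3 Compositions (sorry-free): what the stubs give the engine -/

section Compositions

/-- **T6 package** — the archimedean-cohomology input of the engine as ONE named `Prop` (consumed by the parent line's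
`hJ3a_of_stubs` through E1′∕E2′ and by P2a's B4 desk): purity, `dim ≤ 1`, rigidity, with the two generic door-openers.
(print: Rogawski1990, Prop. 15.2.1 (b)) -/
def ArchDegOnePackage : Prop :=
  StubT6aDegOneTypePure ∧ StubT6bDegOneTypeFinrank ∧ StubT6cDegOneTypeRigid ∧
    StubT6dAdmissibleBridge ∧ StubT6eCasimirScalar ∧ StubT3jCocycleValuesPNull

/-- Registry head: the package holds once the six stubs are proved. [cite: Rogawski1990, Prop. 15.2.1 (b)] -/
theorem archDegOnePackage_holds_of (h6a : StubT6aDegOneTypePure) (h6b : StubT6bDegOneTypeFinrank)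
    (h6c : StubT6cDegOneTypeRigid) (h6d : StubT6dAdmissibleBridge) (h6e : StubT6eCasimirScalar)
    (h3j : StubT3jCocycleValuesPNull) : ArchDegOnePackage :=
  ⟨h6a, h6b, h6c, h6d, h6e, h3j⟩

/-- **THE T6 PACKAGE HOLDS — sorry-free since edition 3** (all of §2 is ★; kernel axioms `propext ∕ Classical.choice ∕ Quot.sound`). [cite: Rogawski1990, Prop. 15.2.1 (b)] -/
theorem archDegOnePackage_holds : ArchDegOnePackage :=
  archDegOnePackage_holds_of stub_T6a_degOneTypePure stub_T6b_degOneTypeFinrank stub_T6c_degOneTypeRigid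
    stub_T6d_admissibleBridge stub_T6e_casimirScalar stub_T3j_cocycleValuesPNull

/-- **Edition-2 registry head**: the T6 package from the FOUR edition-2 stubs T6d, T6g, T6r, T6k (T6e, T3j are ★;
T6a ∕ T6b ∕ T6c are derived). [cite: Rogawski1990, Prop. 15.2.1 (b); BorelWallach2000, VI Thm. 4.11] -/
theorem archDegOnePackage_holds_of_ed2 (h6d : StubT6dAdmissibleBridge) (h6g : StubT6gPNullGeneration)
    (h6r : StubT6rPNullRigidity) (h6k : StubT6kU21PGeometry) : ArchDegOnePackage :=
  archDegOnePackage_holds_of (t6a_of stub_T3j_cocycleValuesPNull h6g) (t6b_of stub_T3j_cocycleValuesPNull h6g h6k)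
    (t6c_of stub_T3j_cocycleValuesPNull h6k h6r) h6d stub_T6e_casimirScalar stub_T3j_cocycleValuesPNull

/-- **BW II 3.4 (1) for the tree's admissible `(𝔤, K)`-modules of `U(α, β)`, DERIVED from T6d and the ★ theorem
`moduleFinite_gkComplex_carrier_of_isKAdmissible`**: every cochain space `C^q(𝔲(α,β), K; V)` is finite-dimensional.
[cite: BorelWallach2000, II Prop. 3.4 (1)] -/
theorem cochainsFinite_of_T6d (h6d : StubT6dAdmissibleBridge) {α β : Type} [Fintype α] [DecidableEq α] [Fintype β]
    [DecidableEq β] {V : Type} [AddCommGroup V] [Module ℂ V]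
    (ρK : Representation ℂ (uFormGroup α β).maximalCompact V) (ρ𝔤 : (uFormGroup α β).lie →ₗ⁅ℝ⁆ Module.End ℂ V)
    (hGK : IsGKModule (uFormGroup α β) ρK ρ𝔤) (hadm : IsAdmissibleGK ρK) (q : ℕ) :
    Module.Finite ℝ ↥((gkComplex (uFormGroup α β) ρK ρ𝔤 hGK.ad_compat).carrier q) :=
  moduleFinite_gkComplex_carrier_of_isKAdmissible (uFormGroup α β) ρK ρ𝔤 hGK.ad_compat (h6d α β V ρK ρ𝔤 hGK hadm) q

variable {V : Type} [AddCommGroup V] [Module ℂ V]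
  (ρK : Representation ℂ (uFormGroup (Fin 2) (Fin 1)).maximalCompact V)
  (ρ𝔤 : (uFormGroup (Fin 2) (Fin 1)).lie →ₗ⁅ℝ⁆ Module.End ℂ V)

/-- **E2′-shaped consequence (Hodge-type exclusion at the archimedean place)**: no irreducible unitary
`(𝔤, K)`-module of `U(2,1)` has both a non-zero `(1,0)`-class and a non-zero `(0,1)`-class — the local reason a
holomorphic and an antiholomorphic cotangent form cannot generate the same `π_∞`. [cite: Rogawski1990, §15.3 ¶1] -/
theorem not_both_types_of_T6a (h6a : StubT6aDegOneTypePure) (h : IsCohUnitaryIrrep ρK ρ𝔤) :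
    ¬ (upqTypeClasses ρK ρ𝔤 h.gk.ad_compat 1 1 ≠ ⊥ ∧ upqTypeClasses ρK ρ𝔤 h.gk.ad_compat 1 (-1) ≠ ⊥) := by
  rintro ⟨h1, h2⟩
  rcases h6a V ρK ρ𝔤 h with h0 | h0
  · exact h1 h0
  · exact h2 h0

/-- **E1′-shaped consequence (one class per type)**: two irreducible unitary `(𝔤, K)`-modules of `U(2,1)` with a
non-zero `(1,0)`-class are equivalent — the archimedean component of a holomorphic-cotangent cohomological form is
pinned. [cite: Rogawski1990, Prop. 15.2.1 (b)] -/
theorem holType_equivalent_of_T6c (h6c : StubT6cDegOneTypeRigid) (h : IsCohUnitaryIrrep ρK ρ𝔤)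
    {V' : Type} [AddCommGroup V'] [Module ℂ V']
    (ρK' : Representation ℂ (uFormGroup (Fin 2) (Fin 1)).maximalCompact V')
    (ρ𝔤' : (uFormGroup (Fin 2) (Fin 1)).lie →ₗ⁅ℝ⁆ Module.End ℂ V') (h' : IsCohUnitaryIrrep ρK' ρ𝔤')
    (hV : upqTypeClasses ρK ρ𝔤 h.gk.ad_compat 1 1 ≠ ⊥) (hV' : upqTypeClasses ρK' ρ𝔤' h'.gk.ad_compat 1 1 ≠ ⊥) :
    AreGKEquivalent ρK ρ𝔤 ρK' ρ𝔤' :=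
  h6c V ρK ρ𝔤 h V' ρK' ρ𝔤' h' 1 (Or.inl rfl) hV hV'

/-- **Rogawski 15.2.1 (b), dimension clause, DERIVED**: for an irreducible unitary `(𝔤, K)`-module of `U(2,1)`,
`dim_ℝ H¹(𝔤, K; V) ≤ 2` (`dim_ℂ ≤ 1`) — from T6d (finite cochains) the tree's II 4.5
`upq_finrank_gkCohomology_eq_sum_typeClasses` gives `dim H¹ = dim H¹_{−1} + dim H¹_{+1}`, T6a kills one summand and
T6b bounds the other. [cite: Rogawski1990, Prop. 15.2.1 (b); BorelWallach2000, II Cor. 4.5] -/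
theorem finrank_H1_le_two_of (h6a : StubT6aDegOneTypePure) (h6b : StubT6bDegOneTypeFinrank)
    (h6d : StubT6dAdmissibleBridge) (h : IsCohUnitaryIrrep ρK ρ𝔤) :
    Module.finrank ℝ (gkCohomology (uFormGroup (Fin 2) (Fin 1)) ρK ρ𝔤 h.gk.ad_compat 1) ≤ 2 := by
  obtain ⟨B, hBs, hB, hBd, hadj, hBz, hBI⟩ := h.unit
  haveI : Module.Finite ℝ ↥((gkComplex (uFormGroup (Fin 2) (Fin 1)) ρK ρ𝔤 h.gk.ad_compat).carrier (0 + 1)) :=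
    cochainsFinite_of_T6d h6d ρK ρ𝔤 h.gk h.adm 1
  have hsum := upq_finrank_gkCohomology_eq_sum_typeClasses ρK ρ𝔤 h.gk.ad_compat hBs hB hBd hadj hBz hBI 0
  have e1 : Module.finrank ℝ (gkCohomology (uFormGroup (Fin 2) (Fin 1)) ρK ρ𝔤 h.gk.ad_compat 1) =
      Module.finrank ℝ ↥(upqTypeClasses ρK ρ𝔤 h.gk.ad_compat 1 (-1)) +
        Module.finrank ℝ ↥(upqTypeClasses ρK ρ𝔤 h.gk.ad_compat 1 1) := by
    have h' := hsum
    simp [Fin.sum_univ_two] at h'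
    convert h' using 2 <;> rfl
  rw [e1]
  rcases h6a V ρK ρ𝔤 h with h0 | h0
  · rw [h0, finrank_bot, add_zero]
    exact (h6b V ρK ρ𝔤 h (-1)).2
  · rw [h0, finrank_bot, zero_add]
    exact (h6b V ρK ρ𝔤 h 1).2

end Compositions

/-! ## §4 (edition 3, sorry-free) Type transport under `GKEquiv`; hol ≇ antihol at the module level from T6a — the ARCHIMEDEAN END of letter E2′ -/

section EditionThree

variable {α β : Type*} [Fintype α] [DecidableEq α] [Fintype β] [DecidableEq β]
  {V : Type*} [AddCommGroup V] [Module ℂ V]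
  {ρK : Representation ℂ (uFormGroup α β).maximalCompact V}
  {ρ𝔤 : (uFormGroup α β).lie →ₗ⁅ℝ⁆ Module.End ℂ V}
  {V' : Type*} [AddCommGroup V'] [Module ℂ V']
  {ρK' : Representation ℂ (uFormGroup α β).maximalCompact V'}
  {ρ𝔤' : (uFormGroup α β).lie →ₗ⁅ℝ⁆ Module.End ℂ V'}

/-- A `(𝔤, K)`-equivalence of `U(α, β)`-pair data transports «`H^n_δ(V) ≠ 0`» (generic; from ★ `GKEquiv.upqTypeClassesEquiv`).
[cite: BorelWallach2000, II §4.2 (3); I §4.3] -/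
theorem upqTypeClasses_ne_bot_of_gkEquiv (hGK : IsGKModule (uFormGroup α β) ρK ρ𝔤)
    (hGK' : IsGKModule (uFormGroup α β) ρK' ρ𝔤') (e : GKEquiv ρK ρ𝔤 ρK' ρ𝔤') {n : ℕ} {δ : ℤ}
    (h : upqTypeClasses ρK ρ𝔤 hGK.ad_compat n δ ≠ ⊥) : upqTypeClasses ρK' ρ𝔤' hGK'.ad_compat n δ ≠ ⊥ := by
  obtain ⟨x, hx, hx0⟩ := (Submodule.ne_bot_iff _).1 h
  refine (Submodule.ne_bot_iff _).2 ⟨_, ((e.upqTypeClassesEquiv hGK.ad_compat hGK'.ad_compat n δ) ⟨x, hx⟩).2, ?_⟩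
  intro h0
  have h1 : (e.upqTypeClassesEquiv hGK.ad_compat hGK'.ad_compat n δ) ⟨x, hx⟩ = 0 := Subtype.ext h0
  have h2 : (⟨x, hx⟩ : upqTypeClasses ρK ρ𝔤 hGK.ad_compat n δ) = 0 := (LinearEquiv.map_eq_zero_iff _).1 h1
  exact hx0 (congrArg Subtype.val h2)

end EditionThree

section EditionThreeU21

variable {V : Type} [AddCommGroup V] [Module ℂ V]
  {ρK : Representation ℂ (uFormGroup (Fin 2) (Fin 1)).maximalCompact V}
  {ρ𝔤 : (uFormGroup (Fin 2) (Fin 1)).lie →ₗ⁅ℝ⁆ Module.End ℂ V}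
  {V' : Type} [AddCommGroup V'] [Module ℂ V']
  {ρK' : Representation ℂ (uFormGroup (Fin 2) (Fin 1)).maximalCompact V'}
  {ρ𝔤' : (uFormGroup (Fin 2) (Fin 1)).lie →ₗ⁅ℝ⁆ Module.End ℂ V'}

/-- **E2′-shaped consequence of T6a (hol ≠ antihol at the module level)**: an irreducible unitary `(𝔤, K)`-module of
`U(2,1)` with a non-zero `(1,0)`-class and one with a non-zero `(0,1)`-class are NOT `(𝔤, K)`-equivalent — transport the
`(1,0)`-class along the equivalence and apply T6a purity to the second module. [cite: Rogawski1990, Prop. 15.2.1 (b)]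
[cite: BorelWallach2000, II §4.2 (3)] -/
theorem hol_antihol_inequivalent_of (h6a : StubT6aDegOneTypePure) (h : IsCohUnitaryIrrep ρK ρ𝔤)
    (h' : IsCohUnitaryIrrep ρK' ρ𝔤')
    (hV : upqTypeClasses ρK ρ𝔤 h.gk.ad_compat 1 1 ≠ ⊥) (hV' : upqTypeClasses ρK' ρ𝔤' h'.gk.ad_compat 1 (-1) ≠ ⊥) :
    ¬ AreGKEquivalent ρK ρ𝔤 ρK' ρ𝔤' := by
  rintro ⟨e⟩
  exact not_both_types_of_T6a ρK' ρ𝔤' h6a h' ⟨upqTypeClasses_ne_bot_of_gkEquiv h.gk h'.gk e hV, hV'⟩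

/-- The same with the roles exchanged (antihol source, hol target). [cite: Rogawski1990, Prop. 15.2.1 (b)] -/
theorem antihol_hol_inequivalent_of (h6a : StubT6aDegOneTypePure) (h : IsCohUnitaryIrrep ρK ρ𝔤)
    (h' : IsCohUnitaryIrrep ρK' ρ𝔤')
    (hV : upqTypeClasses ρK ρ𝔤 h.gk.ad_compat 1 (-1) ≠ ⊥) (hV' : upqTypeClasses ρK' ρ𝔤' h'.gk.ad_compat 1 1 ≠ ⊥) :
    ¬ AreGKEquivalent ρK ρ𝔤 ρK' ρ𝔤' := by
  rintro ⟨e⟩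
  exact not_both_types_of_T6a ρK' ρ𝔤' h6a h' ⟨hV', upqTypeClasses_ne_bot_of_gkEquiv h.gk h'.gk e hV⟩

/-- **«J⁺ ≇ J⁻» OUTRIGHT** (edition 3: `stub_T6a_degOneTypePure` is a theorem): an irreducible unitary `(𝔤, K)`-module of `U(2,1)` with a
non-zero `(1,0)`-class and one with a non-zero `(0,1)`-class are not `(𝔤, K)`-equivalent. [cite: Rogawski1990, Prop. 15.2.1 (b)] -/
theorem hol_antihol_inequivalent (h : IsCohUnitaryIrrep ρK ρ𝔤) (h' : IsCohUnitaryIrrep ρK' ρ𝔤')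
    (hV : upqTypeClasses ρK ρ𝔤 h.gk.ad_compat 1 1 ≠ ⊥) (hV' : upqTypeClasses ρK' ρ𝔤' h'.gk.ad_compat 1 (-1) ≠ ⊥) :
    ¬ AreGKEquivalent ρK ρ𝔤 ρK' ρ𝔤' :=
  hol_antihol_inequivalent_of stub_T6a_degOneTypePure h h' hV hV'

/-- The mirror statement, outright. [cite: Rogawski1990, Prop. 15.2.1 (b)] -/
theorem antihol_hol_inequivalent (h : IsCohUnitaryIrrep ρK ρ𝔤) (h' : IsCohUnitaryIrrep ρK' ρ𝔤')
    (hV : upqTypeClasses ρK ρ𝔤 h.gk.ad_compat 1 (-1) ≠ ⊥) (hV' : upqTypeClasses ρK' ρ𝔤' h'.gk.ad_compat 1 1 ≠ ⊥) :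
    ¬ AreGKEquivalent ρK ρ𝔤 ρK' ρ𝔤' :=
  antihol_hol_inequivalent_of stub_T6a_degOneTypePure h h' hV hV'

end EditionThreeU21

end Summit.HodgeConjecture.HodgeConjecture.Cruxes.H413.F0EngineLocalPackets
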